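import Literature.MathematicalPhysics.QuantumLattice.NagaokaTasaki
import Literature.MathematicalPhysics.QuantumLattice.HubbardLiebConfig
import HarnessLib

/-!
# One-hole configurations of the `U = ∞` Hubbard model: holes, hops and spin counts

Structure lemmas for the vocabulary of `NagaokaTasaki.lean` (`Orb`, `orb`, `HasDoubleOccupancy`,
`OneHoleConfig`, `IsHoleHop`, `holeHopGraph`, `upCount`; `orb_inj`, `upPart`, `downPart` and
`card_eq_upPart_add_downPart` come from `HubbardLiebConfig.lean`), used in
`NagaokaTasakiConnectivity.lean` to analyse Tasaki's connectivity condition: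

* a one-hole configuration has exactly one empty site (`OneHoleConfig.exists_hole`,
  `OneHoleConfig.hole_unique`) — `|Λ| - 1` electrons, at most one per site;
* one hop of the hole (the spin-`σ` electron at `y` moves into the empty site `x`) keeps the
  electron number, the no-double-occupancy constraint and every spin count, and leaves the hole
  at `y` (`card_hop`, `not_hasDoubleOccupancy_hop`, `card_filter_orb_mem_hop`, `orb_notMem_hop`,
  `OneHoleConfig.exists_adj_hop`);
* bookkeeping of MISPLACED electrons `|s \ s'|` relative to a target `s'` under a hop
  (`card_hop_sdiff_of_mem`, `card_hop_sdiff_of_notMem`, `OneHoleConfig.exists_adj_card_sdiff_lt`);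
* the polarised configuration (hole at `a`, spin `↑` elsewhere: `OneHoleConfig.exists_polarized`)
  and the fact that along a walk in the hole-hopping graph the hole walks in `G`
  (`OneHoleConfig.reachable_of_walk`).

Sources: H. Tasaki, Phys. Rev. B **40** (1989) 9192 (the one-hole `U = ∞` model and its hole
hops) [cite: Tasaki1989, the connectivity condition]; H. Tasaki, J. Phys. Cond. Mat. **10** (1998)
4353 = arXiv:cond-mat/9512169, Theorem 6.3. Elementary finite combinatorics; no new definitions
(spin counts are written `(univ.filter fun x => orb x σ ∈ s).card`; `upCount s` is the case
`σ = 0`).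
-/

noncomputable section

open Finset

namespace Literature.MathematicalPhysics.QuantumLattice

variable {Λ : Type*} [LinearOrder Λ] [Fintype Λ]

/-! ### Orbitals, double occupancy and one hole hop (finset level) -/

section OrbLemmas

omit [Fintype Λ]

omit [LinearOrder Λ] in
/-- Every orbital is `orb` of its site and its spin. [folklore] -/
@[simp] theorem orb_ofLex (o : Orb Λ) : orb (ofLex o).1 (ofLex o).2 = o := by
  simp [orb]

omit [LinearOrder Λ] in
/-- Without double occupancy a site carries at most one spin. [folklore] -/
theorem spin_unique_of_not_hasDoubleOccupancy {s : Finset (Orb Λ)} (hs : ¬ HasDoubleOccupancy s)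
    {x : Λ} {σ τ : Fin 2} (hσ : orb x σ ∈ s) (hτ : orb x τ ∈ s) : σ = τ := by
  by_contra hne
  apply hs
  fin_cases σ <;> fin_cases τ
  · exact absurd rfl hne
  · exact ⟨x, hσ, hτ⟩
  · exact ⟨x, hτ, hσ⟩
  · exact absurd rfl hne

omit [LinearOrder Λ] in
/-- Without double occupancy, the occupied orbitals are determined by their sites. [folklore] -/
theorem site_injOn_of_not_hasDoubleOccupancy {s : Finset (Orb Λ)} (hs : ¬ HasDoubleOccupancy s) :
    Set.InjOn (fun o : Orb Λ => (ofLex o).1) ↑s := by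
  intro o ho o' ho' h
  rw [← orb_ofLex o] at ho
  rw [← orb_ofLex o'] at ho'
  simp only at h
  rw [h] at ho
  rw [← orb_ofLex o, ← orb_ofLex o', h, spin_unique_of_not_hasDoubleOccupancy hs ho ho']

/-- Membership in the configuration obtained by one hole hop (the spin-`σ` electron at `y` moves
into the empty site `x`). [folklore] -/
theorem orb_mem_hop_iff {s : Finset (Orb Λ)} {x y : Λ} {σ : Fin 2} (z : Λ) (τ : Fin 2) :
    orb z τ ∈ insert (orb x σ) (s.erase (orb y σ)) ↔
      (z = x ∧ τ = σ) ∨ (¬ (z = y ∧ τ = σ) ∧ orb z τ ∈ s) := by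
  simp [Finset.mem_insert, Finset.mem_erase]

/-- A hole hop preserves the no-double-occupancy constraint. [folklore] -/
theorem not_hasDoubleOccupancy_hop {s : Finset (Orb Λ)} (hs : ¬ HasDoubleOccupancy s) {x y : Λ}
    {σ : Fin 2} (hx : ∀ τ, orb x τ ∉ s) :
    ¬ HasDoubleOccupancy (insert (orb x σ) (s.erase (orb y σ))) := by
  rintro ⟨z, h0, h1⟩
  rw [orb_mem_hop_iff] at h0 h1
  rcases h0 with ⟨rfl, h0⟩ | ⟨-, h0⟩ <;> rcases h1 with ⟨h1, h1'⟩ | ⟨-, h1⟩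
  · exact absurd (h0.trans h1'.symm) (by decide)
  · exact hx 1 h1
  · exact hx 0 (h1 ▸ h0)
  · exact hs ⟨z, h0, h1⟩

/-- A hole hop preserves the number of electrons. [folklore] -/
theorem card_hop {s : Finset (Orb Λ)} {x y : Λ} {σ : Fin 2} (hx : ∀ τ, orb x τ ∉ s)
    (hy : orb y σ ∈ s) : (insert (orb x σ) (s.erase (orb y σ))).card = s.card := by
  rw [card_insert_of_notMem (fun h => hx σ (mem_of_mem_erase h)), card_erase_of_mem hy]
  have : 0 < s.card := card_pos.2 ⟨_, hy⟩
  omega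

/-- After the hop the source site `y` is the new hole. [folklore] -/
theorem orb_notMem_hop {s : Finset (Orb Λ)} (hs : ¬ HasDoubleOccupancy s) {x y : Λ} {σ : Fin 2}
    (hx : ∀ τ, orb x τ ∉ s) (hy : orb y σ ∈ s) (τ : Fin 2) :
    orb y τ ∉ insert (orb x σ) (s.erase (orb y σ)) := by
  rw [orb_mem_hop_iff]
  rintro (⟨rfl, rfl⟩ | ⟨hne, hmem⟩)
  · exact hx _ hy
  · exact hne ⟨rfl, spin_unique_of_not_hasDoubleOccupancy hs hmem hy⟩

/-- A FILLING hop — the target `s'` wants spin `τ` at the hole `x` and a MISPLACED spin-`τ`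
electron moves in — removes exactly one misplaced electron. [folklore] -/
theorem card_hop_sdiff_of_mem {s s' : Finset (Orb Λ)} {x y : Λ} {τ : Fin 2}
    (hx' : orb x τ ∈ s') (hy : orb y τ ∈ s) (hy' : orb y τ ∉ s') :
    (insert (orb x τ) (s.erase (orb y τ)) \ s').card + 1 = (s \ s').card := by
  have h1 : insert (orb x τ) (s.erase (orb y τ)) \ s' = (s \ s').erase (orb y τ) := by
    ext o
    simp only [mem_sdiff, mem_insert, mem_erase]
    constructor
    · rintro ⟨rfl | ⟨hne, ho⟩, ho'⟩
      · exact absurd hx' ho'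
      · exact ⟨hne, ho, ho'⟩
    · rintro ⟨hne, ho, ho'⟩
      exact ⟨Or.inr ⟨hne, ho⟩, ho'⟩
  rw [h1, card_erase_of_mem (mem_sdiff.2 ⟨hy, hy'⟩)]
  have : 0 < (s \ s').card := card_pos.2 ⟨_, mem_sdiff.2 ⟨hy, hy'⟩⟩
  omega

/-- A hop into a site that is ALSO empty in the target `s'`, moving a misplaced electron, keeps the
number of misplaced electrons. [folklore] -/
theorem card_hop_sdiff_of_notMem {s s' : Finset (Orb Λ)} {x y : Λ} {σ : Fin 2}
    (hx : ∀ τ, orb x τ ∉ s) (hx' : ∀ τ, orb x τ ∉ s') (hy : orb y σ ∈ s)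
    (hy' : orb y σ ∉ s') :
    (insert (orb x σ) (s.erase (orb y σ)) \ s').card = (s \ s').card := by
  have h1 : insert (orb x σ) (s.erase (orb y σ)) \ s' =
      insert (orb x σ) ((s \ s').erase (orb y σ)) := by
    ext o
    simp only [mem_sdiff, mem_insert, mem_erase]
    constructor
    · rintro ⟨rfl | ⟨hne, ho⟩, ho'⟩
      · exact Or.inl rfl
      · exact Or.inr ⟨hne, ho, ho'⟩
    · rintro (rfl | ⟨hne, ho, ho'⟩)
      · exact ⟨Or.inl rfl, hx' σ⟩
      · exact ⟨Or.inr ⟨hne, ho⟩, ho'⟩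
  rw [h1, card_insert_of_notMem (fun h => hx σ (mem_sdiff.1 (mem_of_mem_erase h)).1),
    card_erase_of_mem (mem_sdiff.2 ⟨hy, hy'⟩)]
  have : 0 < (s \ s').card := card_pos.2 ⟨_, mem_sdiff.2 ⟨hy, hy'⟩⟩
  omega

/-- Hole hops are monotone in the hopping graph. [folklore] -/
theorem IsHoleHop.mono {G G' : SimpleGraph Λ} (hle : G ≤ G') {s s' : Finset (Orb Λ)}
    (h : IsHoleHop G s s') : IsHoleHop G' s s' := by
  obtain ⟨x, y, σ, hxy, rest⟩ := h
  exact ⟨x, y, σ, hle hxy, rest⟩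

end OrbLemmas

/-! ### Spin counts (`upCount s` is the case `σ = 0`) -/

/-- A hole hop preserves every spin count (in particular `upCount`, i.e. `S^z`). [folklore] -/
theorem card_filter_orb_mem_hop {s : Finset (Orb Λ)} {x y : Λ} {σ : Fin 2}
    (hx : ∀ τ, orb x τ ∉ s) (hy : orb y σ ∈ s) (τ : Fin 2) :
    (univ.filter fun z : Λ => orb z τ ∈ insert (orb x σ) (s.erase (orb y σ))).card =
      (univ.filter fun z : Λ => orb z τ ∈ s).card := by
  by_cases hτ : τ = σ
  · subst hτ
    have h : (univ.filter fun z : Λ => orb z τ ∈ insert (orb x τ) (s.erase (orb y τ))) =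
        insert x ((univ.filter fun z : Λ => orb z τ ∈ s).erase y) := by
      ext z
      simp only [mem_filter, mem_univ, true_and, mem_insert, mem_erase, orb_inj, and_true, ne_eq]
    rw [h, card_insert_of_notMem (by simp [hx τ]), card_erase_of_mem (by simpa using hy)]
    have : 0 < (univ.filter fun z : Λ => orb z τ ∈ s).card :=
      card_pos.2 ⟨y, by simpa using hy⟩
    omega
  · congr 1
    ext z
    simp only [mem_filter, mem_univ, true_and, orb_mem_hop_iff]
    exact ⟨fun h => h.elim (fun h => absurd h.2 hτ) fun h => h.2,
      fun h => Or.inr ⟨fun h' => hτ h'.2, h⟩⟩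

/-- If the target `s'` carries a spin-`τ` electron at a site where `s` does not, and both have the
same number of spin-`τ` electrons, then some spin-`τ` electron of `s` is misplaced. [folklore] -/
theorem exists_orb_mem_notMem {s s' : Finset (Orb Λ)} {x : Λ} {τ : Fin 2} (hx : orb x τ ∉ s)
    (hx' : orb x τ ∈ s') (hcount : (univ.filter fun z : Λ => orb z τ ∈ s).card =
      (univ.filter fun z : Λ => orb z τ ∈ s').card) :
    ∃ y, orb y τ ∈ s ∧ orb y τ ∉ s' := by
  by_contra h
  push Not at h
  have hsub : (univ.filter fun z : Λ => orb z τ ∈ s) ⊂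
      (univ.filter fun z : Λ => orb z τ ∈ s') := by
    rw [ssubset_iff_of_subset]
    · exact ⟨x, by simpa using hx', by simpa using hx⟩
    · intro z hz
      simp only [mem_filter, mem_univ, true_and] at hz ⊢
      exact h z hz
  have := card_lt_card hsub
  omega

/-! ### One-hole configurations: the hole, hops, the polarised configuration -/

namespace OneHoleConfig

/-- A one-hole configuration on a nonempty lattice has an empty site (its hole): `|Λ| - 1`
electrons with at most one per site cannot cover `|Λ|` sites. [folklore] -/
theorem exists_hole [Nonempty Λ] (s : OneHoleConfig Λ) :
    ∃ a : Λ, ∀ σ, orb a σ ∉ s.1 := by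
  by_contra h
  push Not at h
  choose f hf using h
  have hle : (univ : Finset Λ).card ≤ s.1.card :=
    card_le_card_of_injOn (fun a => orb a (f a)) (fun a _ => mem_coe.2 (hf a))
      fun a _ b _ hab => (orb_inj.1 hab).1
  rw [card_univ, s.2.1] at hle
  have := Fintype.card_pos (α := Λ)
  omega

/-- A one-hole configuration has at most one empty site: `|Λ| - 1` electrons with at most one per
site leave at most one site uncovered. [folklore] -/
theorem hole_unique (s : OneHoleConfig Λ) {a b : Λ} (ha : ∀ σ, orb a σ ∉ s.1)
    (hb : ∀ σ, orb b σ ∉ s.1) : a = b := by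
  by_contra hab
  have hmaps : Set.MapsTo (fun o : Orb Λ => (ofLex o).1) ↑s.1 ↑((univ.erase a).erase b) := by
    intro o ho
    rw [mem_coe] at ho ⊢
    simp only [mem_erase, mem_univ, and_true]
    exact ⟨fun h => hb (ofLex o).2 (by rw [← h, orb_ofLex]; exact ho),
      fun h => ha (ofLex o).2 (by rw [← h, orb_ofLex]; exact ho)⟩
  have hle := card_le_card_of_injOn _ hmaps (site_injOn_of_not_hasDoubleOccupancy s.2.2)
  rw [card_erase_of_mem (by simpa using fun h => hab h.symm), card_erase_of_mem (mem_univ a),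
    card_univ, s.2.1] at hle
  have := Fintype.one_lt_card_iff.2 ⟨a, b, hab⟩
  omega

/-- Moving the spin-`σ` electron at `y` into the hole `x` along an edge of `G` gives a one-hole
configuration adjacent to `s` in the hole-hopping graph. [Tasaki 1989, the hole hops of the
connectivity condition] [folklore] -/
theorem exists_adj_hop (s : OneHoleConfig Λ) {G : SimpleGraph Λ} {x y : Λ} {σ : Fin 2}
    (hadj : G.Adj x y) (hx : ∀ τ, orb x τ ∉ s.1) (hy : orb y σ ∈ s.1) :
    ∃ t : OneHoleConfig Λ,
      t.1 = insert (orb x σ) (s.1.erase (orb y σ)) ∧ (holeHopGraph G).Adj s t := by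
  refine ⟨⟨insert (orb x σ) (s.1.erase (orb y σ)), by rw [card_hop hx hy, s.2.1],
    not_hasDoubleOccupancy_hop s.2.2 hx⟩, rfl, ?_⟩
  rw [holeHopGraph, SimpleGraph.fromRel_adj]
  refine ⟨fun h => hx σ ?_, Or.inl ⟨x, y, σ, hadj, hy, hx 0, hx 1, rfl⟩⟩
  have h' := congrArg Subtype.val h
  simp only at h'
  rw [h']
  exact mem_insert_self _ _

/-- One FILLING hop on the complete graph: if the target `s'` wants an electron at the hole of `s`
and the spin counts agree, some adjacent configuration has one misplaced electron fewer (and still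
the spin counts of `s'`). [folklore] -/
theorem exists_adj_card_sdiff_lt {s s' : OneHoleConfig Λ}
    (hcount : ∀ τ, (univ.filter fun z : Λ => orb z τ ∈ s.1).card =
      (univ.filter fun z : Λ => orb z τ ∈ s'.1).card)
    {x : Λ} (hx : ∀ σ, orb x σ ∉ s.1) {τ : Fin 2} (hx' : orb x τ ∈ s'.1) :
    ∃ t : OneHoleConfig Λ, (holeHopGraph ⊤).Adj s t ∧
      (∀ τ, (univ.filter fun z : Λ => orb z τ ∈ t.1).card =
        (univ.filter fun z : Λ => orb z τ ∈ s'.1).card) ∧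
      (t.1 \ s'.1).card + 1 = (s.1 \ s'.1).card := by
  obtain ⟨y, hy, hy'⟩ := exists_orb_mem_notMem (hx τ) hx' (hcount τ)
  have hxy : x ≠ y := by
    rintro rfl
    exact hx τ hy
  obtain ⟨t, ht, hadj⟩ := s.exists_adj_hop ((SimpleGraph.top_adj x y).2 hxy) hx hy
  refine ⟨t, hadj, fun σ => ?_, ?_⟩
  · rw [ht, card_filter_orb_mem_hop hx hy, hcount]
  · rw [ht]
    exact card_hop_sdiff_of_mem hx' hy hy'

/-- The fully polarised one-hole configuration with the hole at `a` (spin `↑` on every other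
site — the configurations spanning the Nagaoka state) exists and has `upCount = |Λ| - 1`.
[folklore] -/
theorem exists_polarized (a : Λ) :
    ∃ s : OneHoleConfig Λ, (∀ σ, orb a σ ∉ s.1) ∧ upCount s.1 = Fintype.card Λ - 1 := by
  have hmem : ∀ (x : Λ) (σ : Fin 2),
      orb x σ ∈ (univ.erase a).image (fun x => orb x 0) ↔ x ≠ a ∧ σ = 0 := by
    intro x σ
    constructor
    · intro h
      obtain ⟨y, hy, hxy⟩ := mem_image.1 h
      obtain ⟨rfl, rfl⟩ := orb_inj.1 hxy
      exact ⟨(mem_erase.1 hy).1, rfl⟩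
    · rintro ⟨hx, rfl⟩
      exact mem_image.2 ⟨x, mem_erase.2 ⟨hx, mem_univ x⟩, rfl⟩
  refine ⟨⟨(univ.erase a).image fun x => orb x 0, ?_, ?_⟩, fun σ => by simp [hmem], ?_⟩
  · rw [card_image_of_injective _ fun x y h => (orb_inj.1 h).1, card_erase_of_mem (mem_univ a),
      card_univ]
  · rintro ⟨x, -, h1⟩
    simp [hmem] at h1
  · have h : (univ.filter fun x : Λ => orb x 0 ∈ (univ.erase a).image fun x => orb x 0) =
        univ.erase a := by
      ext x
      simp [hmem]
    simp only [upCount]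
    rw [h, card_erase_of_mem (mem_univ a), card_univ]

/-- Along a walk in the hole-hopping graph the hole performs a walk in `G`. [folklore] -/
theorem reachable_of_walk {G : SimpleGraph Λ} :
    ∀ {s t : OneHoleConfig Λ} (_ : (holeHopGraph G).Walk s t) {a b : Λ},
      (∀ σ, orb a σ ∉ s.1) → (∀ σ, orb b σ ∉ t.1) → G.Reachable a b
  | s, _, .nil, _, _, ha, hb => s.hole_unique ha hb ▸ SimpleGraph.Reachable.refl _
  | s, _, .cons (v := v) hadj p, a, _, ha, hb => by
    rw [holeHopGraph, SimpleGraph.fromRel_adj] at hadj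
    obtain ⟨-, ⟨x, y, σ, hxy, hy, hx0, hx1, hv⟩ | ⟨x, y, σ, hxy, hy, hx0, hx1, hs⟩⟩ :=
      hadj
    · have hx : ∀ τ, orb x τ ∉ s.1 := Fin.forall_fin_two.2 ⟨hx0, hx1⟩
      have hyv : ∀ τ, orb y τ ∉ v.1 := by
        rw [hv]
        exact orb_notMem_hop s.2.2 hx hy
      exact s.hole_unique ha hx ▸ hxy.reachable.trans (reachable_of_walk p hyv hb)
    · have hx : ∀ τ, orb x τ ∉ v.1 := Fin.forall_fin_two.2 ⟨hx0, hx1⟩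
      have hys : ∀ τ, orb y τ ∉ s.1 := by
        rw [hs]
        exact orb_notMem_hop v.2.2 hx hy
      exact s.hole_unique ha hys ▸ hxy.symm.reachable.trans (reachable_of_walk p hx hb)

end OneHoleConfig

end Literature.MathematicalPhysics.QuantumLattice
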